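/-
HONEST FRAMING: certified error envelopes and provably optimal rounding/accumulation schemes for
low-precision formats under stated cost models; every table by two implementations; no hardware
or vendor claims.
-/
import Summits.Ventures.CertifiedArithmetic.LowPrec.OptDemotionRoutingR32Arith
import Summits.Ventures.CertifiedArithmetic.LowPrec.OptDemotionRoutingThreeFam
import Summits.Ventures.CertifiedArithmetic.LowPrec.OptDemotionRoutingRows

/-!
# The demotion law (Theorem T8), part 10h-b: opt's R32 — the single-bit top-level `O`-rows — FOR EVERY `q`

opt gen 15 §5b (R32): `O1(j): x_(j-1,q-1) ≤ (1+u) x_j + (1-u) 2^-j x_{q-j}` — the o-side split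
target `(O_u)(β = ½, A = 2^-j)` — was certified there for `5 ≤ q ≤ 40` by a `q`-uniform but
regime-dependent certificate SCHEME whose hard branch is routed through the two-bit e-side rows
(R33).  THIS FILE proves it FOR EVERY `q ≥ 4` and every `1 ≤ a ≤ q - 2` (`j = a + 1`) by a
REGIME-FREE four-branch certificate found by the lean seat (exact LP over the closed ten-coordinate
system `x₀, x₁, x_a, x_{a+1}, x_c, x_{c+1}, x_{q-1}, T(a,q-1), T(c,c+1)`, `c = q-1-a`, then Cramer
over `ℚ[u, w]`, `u = 2^-q`, `w = 2^-(a+1)`): besides the induction hypothesis, (M), (MC), R21g and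
R31 it uses ONE instance of single-family DELETION (part 10g `treeBR_le_erase_add`, opt's (DEL)
row, absent from the gen-15 three-family pool) — which is what makes the hard branch
`x₀(a) + 2^-a T_{c,c+1}(b)` elementary (`T_{c,c+1} ≤ x_c + 2^-(c+1) x₀`, then R21g on `x_c`).  The
four pure-arithmetic branch lemmas `oRow1_branch0..3` (part 10h-a) carry the closed-form multipliers (cleared
of denominators; every sign condition is discharged for ALL `0 < u ≤ 1/16`, `2u ≤ w ≤ ¼` by an
explicit decomposition into products of `u, w, w - 2u, 1/16 - u, ¼ - w`; generated and
identity-checked by sessions work/orow/gen_lean_r32.py).  Main results: `treeBR_oRow1`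
(`T(a,q-1) ≤ (1+u) x_{a+1} + (1-u) 2^-(a+1) x_{q-1-a}`, every tree), and in the budget units of
parts 9d/10e: **`oRow_top_singleBit`** — `ORow q t u (q-2) (2^i)` for every tree, every `q ≥ 4`,
every `i ≤ q - 3`.  With parts 10c/10e/10f: EVERY row of opt's split at the top level `β = 2^(q-2)`
with a single-bit or zero offset, on both sides, holds at `ρ = u` for every tree and every `q`.
-/

namespace Summit.Ventures.CertifiedArithmetic.LowPrec.Opt

open Literature.ComputerArithmetic.JeannerodRump2018
open Literature.ComputerArithmetic.JeannerodRump2018.SumTree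

/-! ## Node values of two-bit coordinates: the two A-oriented splits -/

section R32

variable {q : ℕ}

/-- LOWER BOUNDS AT A NODE for `BR{0,-i}`: the splits `({0,-i} | {-q})` and `({0} | {-i,-q})`. -/
theorem treeBR_pair_node_ge (hq : 1 ≤ q) (A B : SumTree) {i : ℕ} (hi1 : 1 ≤ i) (hiq : i + 1 ≤ q) :
    1 + (treeBR q A {0, -(i : ℤ)} + treeBR q B {-(q : ℤ)}) ≤ treeBR q (.node A B) {0, -(i : ℤ)} ∧
      1 + (treeBR q A {0} + treeBR q B {-(i : ℤ), -(q : ℤ)}) ≤ treeBR q (.node A B) {0, -(i : ℤ)} := by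
  classical
  have hne : ({0, -(i : ℤ)} : Finset ℤ).Nonempty := Finset.insert_nonempty _ _
  have hmax : ({0, -(i : ℤ)} : Finset ℤ).max' hne = 0 := by
    refine le_antisymm (Finset.max'_le _ hne _ fun z hz => ?_) (Finset.le_max' _ _ (by simp))
    simp only [Finset.mem_insert, Finset.mem_singleton] at hz; omega
  have hS : Routable q ({0, -(i : ℤ)} : Finset ℤ) := routable_zero_pair (by omega) (by omega)
  have hlow : Routable q ({-(i : ℤ), -(q : ℤ)} : Finset ℤ) := by
    intro x hx y hy
    simp only [Finset.mem_insert, Finset.mem_singleton] at hx hy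
    rcases hx with rfl | rfl <;> rcases hy with rfl | rfl <;> omega
  have m1 : (({0, -(i : ℤ)} : Finset ℤ), ({-(q : ℤ)} : Finset ℤ)) ∈
      splits q ({0, -(i : ℤ)} : Finset ℤ) (({0, -(i : ℤ)} : Finset ℤ).max' hne) := by
    rw [hmax]
    refine mem_splits.2 ⟨Or.inr ⟨Finset.subset_insert _ _, ?_⟩, hS, routable_singleton hq _⟩
    show ({-(q : ℤ)} : Finset ℤ) = insert ((0 : ℤ) - q) {0, -(i : ℤ)} \ {0, -(i : ℤ)}
    ext z
    simp only [Finset.mem_singleton, Finset.mem_sdiff, Finset.mem_insert]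
    omega
  have m2 : (({0} : Finset ℤ), ({-(i : ℤ), -(q : ℤ)} : Finset ℤ)) ∈
      splits q ({0, -(i : ℤ)} : Finset ℤ) (({0, -(i : ℤ)} : Finset ℤ).max' hne) := by
    rw [hmax]
    refine mem_splits.2 ⟨Or.inr ⟨?_, ?_⟩, routable_singleton hq _, hlow⟩
    · intro z hz
      rw [Finset.mem_singleton] at hz
      simp [hz]
    · show ({-(i : ℤ), -(q : ℤ)} : Finset ℤ) = insert ((0 : ℤ) - q) {0, -(i : ℤ)} \ {0}
      ext z
      simp only [Finset.mem_singleton, Finset.mem_sdiff, Finset.mem_insert]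
      omega
  have s1 := split_le_treeBRw_node (q := q) (W := fun e => (2 : ℚ) ^ e) (a := A) (b := B) hne m1
  have s2 := split_le_treeBRw_node (q := q) (W := fun e => (2 : ℚ) ^ e) (a := A) (b := B) hne m2
  rw [hmax, zpow_zero] at s1 s2
  exact ⟨s1, s2⟩

/-- Shift of a single bit: `BR{k} = 2^k BR{0}`. -/
theorem treeBR_single_shift (t : SumTree) (k : ℤ) : treeBR q t {k} = (2 : ℚ) ^ k * treeBR q t {0} := by
  have := treeBR_image_add (q := q) t ({0} : Finset ℤ) k
  rw [Finset.image_singleton, zero_add] at this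
  exact this

/-- Shift of a pair: `BR{k, e + k} = 2^k BR{0, e}`. -/
theorem treeBR_pair_shift (t : SumTree) (k e : ℤ) :
    treeBR q t {k, e + k} = (2 : ℚ) ^ k * treeBR q t {0, e} := by
  have := treeBR_image_add (q := q) t ({0, e} : Finset ℤ) k
  rw [image_pair_add, zero_add] at this
  exact this

/-- Shift of a triple: `BR{k, e + k, f + k} = 2^k BR{0, e, f}`. -/
theorem treeBR_triple_shift (t : SumTree) (k e f : ℤ) :
    treeBR q t {k, e + k, f + k} = (2 : ℚ) ^ k * treeBR q t {0, e, f} := by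
  have := treeBR_image_add (q := q) t ({0, e, f} : Finset ℤ) k
  rw [Finset.image_insert, image_pair_add, zero_add] at this
  exact this

/-- **R32 FOR EVERY `q` (opt gen 15, O1(j) with j = a+1): for `q ≥ 4`, `1 ≤ a ≤ q-2` and every
tree, `BR_t{0,-a,-(q-1)} ≤ (1+u) BR_t{0,-(a+1)} + (1-u) 2^-(a+1) BR_t{0,-(q-1-a)}`, `u = 2^-q`. -/
theorem treeBR_oRow1 (hq : 4 ≤ q) {a : ℕ} (ha : 1 ≤ a) (haq : a + 2 ≤ q) : ∀ t : SumTree,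
    treeBR q t {0, -(a : ℤ), -((q : ℤ) - 1)} ≤
      (1 + unitRoundoff q) * treeBR q t {0, -((a : ℤ) + 1)} +
        (1 - unitRoundoff q) * (2 : ℚ) ^ (-((a : ℤ) + 1)) * treeBR q t {0, -((q : ℤ) - 1 - a)} := by
  have hq1 : 1 ≤ q := by omega
  obtain ⟨c, hc⟩ : ∃ c : ℕ, (c : ℤ) = (q : ℤ) - 1 - a := ⟨q - 1 - a, by omega⟩
  have hc1 : 1 ≤ c := by omega
  rw [← hc]
  set u := unitRoundoff q with hudef
  set w : ℚ := (2 : ℚ) ^ (-((a : ℤ) + 1)) with hwdef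
  -- scalar facts
  have huz : u = (2 : ℚ) ^ (-(q : ℤ)) := unitRoundoff_eq_zpow q
  have hu0 : 0 < u := by rw [huz]; exact zpow_pos (by norm_num) _
  have hu1 : u ≤ 1 / 16 := by
    rw [huz]
    have : (2 : ℚ) ^ (-(q : ℤ)) ≤ (2 : ℚ) ^ (-4 : ℤ) := zpow_le_zpow_right₀ (by norm_num) (by omega)
    have e : (2 : ℚ) ^ (-4 : ℤ) = 1 / 16 := by norm_num
    rwa [e] at this
  have hw0 : 2 * u ≤ w := by
    rw [huz, hwdef, show (2 : ℚ) * (2 : ℚ) ^ (-(q : ℤ)) = (2 : ℚ) ^ (-(q : ℤ) + 1) by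
      rw [zpow_add_one₀ (by norm_num)]; ring]
    exact zpow_le_zpow_right₀ (by norm_num) (by omega)
  have hw1 : w ≤ 1 / 4 := by
    rw [hwdef]
    have : (2 : ℚ) ^ (-((a : ℤ) + 1)) ≤ (2 : ℚ) ^ (-2 : ℤ) := zpow_le_zpow_right₀ (by norm_num) (by omega)
    have e : (2 : ℚ) ^ (-2 : ℤ) = 1 / 4 := by norm_num
    rwa [e] at this
  have hw0' : 0 < w := by linarith only [hu0, hw0]
  -- products of powers used by the shifts
  have h2u : (2 : ℚ) ^ (-((q : ℤ) - 1)) = 2 * u := by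
    rw [huz, show (-((q : ℤ) - 1)) = -(q : ℤ) + 1 by ring, zpow_add_one₀ (by norm_num)]; ring
  have h2w : (2 : ℚ) ^ (-(a : ℤ)) = 2 * w := by
    rw [hwdef, show (-(a : ℤ)) = -((a : ℤ) + 1) + 1 by ring, zpow_add_one₀ (by norm_num)]; ring
  have hcw : (2 : ℚ) ^ (-(c : ℤ)) * w = u := by
    rw [hwdef, huz, ← zpow_add₀ (by norm_num : (2 : ℚ) ≠ 0)]; congr 1; omega
  have hc1w : 2 * w * (2 : ℚ) ^ (-((c : ℤ) + 1)) = u := by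
    have e : (2 : ℚ) * (2 : ℚ) ^ (-((c : ℤ) + 1)) = (2 : ℚ) ^ (-(c : ℤ)) := by
      rw [show (-(c : ℤ)) = -((c : ℤ) + 1) + 1 by ring, zpow_add_one₀ (by norm_num : (2 : ℚ) ≠ 0)]; ring
    rw [show 2 * w * (2 : ℚ) ^ (-((c : ℤ) + 1)) = (2 * (2 : ℚ) ^ (-((c : ℤ) + 1))) * w by ring, e, hcw]
  have hD : (1 : ℚ) + u + u * u ≠ 0 := by positivity
  ------------------------------------------------------------------ per-child facts
  -- rows on a child X (each a theorem for every tree)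
  have rowR31 : ∀ X : SumTree, 0 ≤ (-1) * treeBR q X {0, -(a : ℤ)} + (1 - u) * treeBR q X {0, -((a : ℤ) + 1)} +
      (w + u * w) * treeBR q X {0, -(c : ℤ)} := by
    intro X
    have h := treeBR_twoFam_le (by omega : 3 ≤ q) (j := a + 1) (by omega) (by omega) X
    have e1 : treeBR q X {-1, -((a + 1 : ℕ) : ℤ)} = (2 : ℚ) ^ (-1 : ℤ) * treeBR q X {0, -(a : ℤ)} := by
      rw [← treeBR_pair_shift X (-1) (-(a : ℤ))]; congr 1; ext z; simp; omega
    have e2 : treeBR q X {-((a + 1 : ℕ) : ℤ), -(q : ℤ)} = w * treeBR q X {0, -(c : ℤ)} := by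
      rw [hwdef, ← treeBR_pair_shift X (-((a : ℤ) + 1)) (-(c : ℤ))]; congr 1; ext z; simp; omega
    have e3 : ({0, -((a + 1 : ℕ) : ℤ)} : Finset ℤ) = {0, -((a : ℤ) + 1)} := by ext z; simp
    rw [e1, e2, e3, zpow_neg_one, ← hudef] at h
    linarith only [h]
  have rowR21 : ∀ (X : SumTree) (i : ℕ), 1 ≤ i → i + 1 ≤ q →
      (1 + u + u * u) * treeBR q X {0, -(i : ℤ)} ≤ (1 + u + (2 : ℚ) ^ (-(i : ℤ))) * treeBR q X {0} := by
    intro X i hi hiq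
    have h := treeBR_twoFam_ratio (by omega : 2 ≤ q) hi hiq X
    rw [← hudef] at h
    have hpos : 0 < 1 + u + u * u := by positivity
    have h' := mul_le_mul_of_nonneg_left h hpos.le
    have e : (1 + u + u * u) * ((1 + u + (2 : ℚ) ^ (-(i : ℤ))) / (1 + u + u * u) * treeBR q X {0}) =
        (1 + u + (2 : ℚ) ^ (-(i : ℤ))) * treeBR q X {0} := by
      field_simp
    rw [e] at h'
    exact h'
  have rowMC : ∀ X : SumTree, 0 ≤ (-2) * treeBR q X {0, -((c : ℤ) + 1)} + 1 * treeBR q X {0, -(c : ℤ)} +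
      1 * treeBR q X {0} := by
    intro X
    have h := two_treeBR_pair_le (q := q) X (e := -((c : ℤ) + 1)) (by omega) (by omega)
    rw [show -((c : ℤ) + 1) + 1 = -(c : ℤ) by ring] at h
    linarith only [h]
  have rowM0 : ∀ (X : SumTree) (e : ℤ), e < 0 → 1 - (q : ℤ) ≤ e → 0 ≤ (-1) * treeBR q X {0} + 1 * treeBR q X {0, e} := by
    intro X e he heq
    have h := treeBR_le_of_subset hq1 X (B := ({0} : Finset ℤ)) (C := ({0, e} : Finset ℤ))
      (by intro z hz; rw [Finset.mem_singleton] at hz; simp [hz]) (routable_zero_pair he heq)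
    linarith only [h]
  have rowMtop : ∀ X : SumTree, 0 ≤ (-1) * treeBR q X {0, -((q : ℤ) - 1)} + 1 * treeBR q X {0, -((c : ℤ) + 1)} := by
    intro X
    have h := treeBR_mono hq1 X (S := ({0, -((q : ℤ) - 1)} : Finset ℤ)) (S' := ({0, -((c : ℤ) + 1)} : Finset ℤ))
      (Finset.insert_nonempty _ _) (Finset.insert_nonempty _ _) (routable_zero_pair (by omega) (by omega))
      (routable_zero_pair (by omega) (by omega)) (by
        rw [val_pair (by omega), val_pair (by omega)]
        have : (2 : ℚ) ^ (-((q : ℤ) - 1)) ≤ (2 : ℚ) ^ (-((c : ℤ) + 1)) := zpow_le_zpow_right₀ (by norm_num) (by omega)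
        linarith only [this])
    linarith only [h]
  have rowDEL : ∀ X : SumTree, 0 ≤ (-2 * w) * treeBR q X {0, -(c : ℤ), -((c : ℤ) + 1)} +
      (2 * w) * treeBR q X {0, -(c : ℤ)} + u * treeBR q X {0} := by
    intro X
    have hS : Routable q ({0, -(c : ℤ), -((c : ℤ) + 1)} : Finset ℤ) := by
      intro x hx y hy
      simp only [Finset.mem_insert, Finset.mem_singleton] at hx hy
      rcases hx with rfl | rfl | rfl <;> rcases hy with rfl | rfl | rfl <;> omega
    have h := treeBR_le_erase_add X hS (b := -((c : ℤ) + 1)) (by simp)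
    have e1 : ({0, -(c : ℤ), -((c : ℤ) + 1)} : Finset ℤ).erase (-((c : ℤ) + 1)) = {0, -(c : ℤ)} := by
      ext z; simp only [Finset.mem_erase, Finset.mem_insert, Finset.mem_singleton]; omega
    rw [e1, treeBR_single_shift] at h
    have h' := mul_le_mul_of_nonneg_left h (by positivity : (0 : ℚ) ≤ 2 * w)
    rw [mul_add, show 2 * w * ((2 : ℚ) ^ (-((c : ℤ) + 1)) * treeBR q X {0}) =
      (2 * w * (2 : ℚ) ^ (-((c : ℤ) + 1))) * treeBR q X {0} by ring, hc1w] at h'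
    linarith only [h']
  -- options at a node (lower bounds for the two-bit coordinates of the node)
  have optA1 : ∀ A B : SumTree,
      1 + (1 * treeBR q A {0, -((a : ℤ) + 1)} + u * treeBR q B {0}) ≤ treeBR q (.node A B) {0, -((a : ℤ) + 1)} ∧
      1 + (1 * treeBR q A {0} + w * treeBR q B {0, -(c : ℤ)}) ≤ treeBR q (.node A B) {0, -((a : ℤ) + 1)} := by
    intro A B
    obtain ⟨s1, s2⟩ := treeBR_pair_node_ge hq1 A B (i := a + 1) (by omega) (by omega)
    have e0 : ({0, -((a + 1 : ℕ) : ℤ)} : Finset ℤ) = {0, -((a : ℤ) + 1)} := by ext z; simp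
    have e1 : treeBR q B {-(q : ℤ)} = u * treeBR q B {0} := by rw [treeBR_single_shift, huz]
    have e2 : treeBR q B {-((a + 1 : ℕ) : ℤ), -(q : ℤ)} = w * treeBR q B {0, -(c : ℤ)} := by
      rw [hwdef, ← treeBR_pair_shift B (-((a : ℤ) + 1)) (-(c : ℤ))]; congr 1; ext z; simp; omega
    rw [e0] at s1 s2; rw [e1] at s1; rw [e2] at s2
    exact ⟨by linarith only [s1], by linarith only [s2]⟩
  have optC : ∀ A B : SumTree,
      1 + (1 * treeBR q A {0, -(c : ℤ)} + u * treeBR q B {0}) ≤ treeBR q (.node A B) {0, -(c : ℤ)} ∧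
      w + (w * treeBR q A {0} + u * treeBR q B {0, -((a : ℤ) + 1)}) ≤ w * treeBR q (.node A B) {0, -(c : ℤ)} := by
    intro A B
    obtain ⟨s1, s2⟩ := treeBR_pair_node_ge hq1 A B (i := c) hc1 (by omega)
    have e1 : treeBR q B {-(q : ℤ)} = u * treeBR q B {0} := by rw [treeBR_single_shift, huz]
    have e2 : treeBR q B {-(c : ℤ), -(q : ℤ)} = (2 : ℚ) ^ (-(c : ℤ)) * treeBR q B {0, -((a : ℤ) + 1)} := by
      rw [← treeBR_pair_shift B (-(c : ℤ)) (-((a : ℤ) + 1))]; congr 1; ext z; simp; omega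
    rw [e1] at s1; rw [e2] at s2
    refine ⟨by linarith only [s1], ?_⟩
    have s2' := mul_le_mul_of_nonneg_left s2 hw0'.le
    have e3 : w * ((2 : ℚ) ^ (-(c : ℤ)) * treeBR q B {0, -((a : ℤ) + 1)}) = u * treeBR q B {0, -((a : ℤ) + 1)} := by
      rw [← mul_assoc, mul_comm w, hcw]
    rw [mul_add, mul_one, mul_add, e3] at s2'
    linarith only [s2']
  -- symmetry of the node
  have comm : ∀ (A B : SumTree) (S : Finset ℤ), treeBR q (.node B A) S = treeBR q (.node A B) S :=
    fun A B S => by unfold treeBR; exact treeBRw_node_comm q _ B A S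
  ------------------------------------------------------------------ the induction
  intro t
  induction t with
  | leaf z => simp [treeBR]
  | node A B ihA ihB =>
    -- node values of the right-hand coordinates
    set NA1 := treeBR q (.node A B) {0, -((a : ℤ) + 1)} with hNA1
    set NC := treeBR q (.node A B) {0, -(c : ℤ)} with hNC
    obtain ⟨oA1_0ab, oA1_1ab⟩ := optA1 A B
    obtain ⟨oA1_0ba, oA1_1ba⟩ := optA1 B A
    obtain ⟨oC_0ab, oC_1ab⟩ := optC A B
    obtain ⟨oC_0ba, oC_1ba⟩ := optC B A
    rw [comm] at oA1_0ba oA1_1ba oC_0ba oC_1ba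
    -- nonnegativity
    have n0 : ∀ (X : SumTree) (S : Finset ℤ), 0 ≤ treeBR q X S := fun X S => treeBR_nonneg q X S
    -- the induction hypotheses as rows
    have ihA' : 0 ≤ (-1) * treeBR q A {0, -(a : ℤ), -((q : ℤ) - 1)} + (1 + u) * treeBR q A {0, -((a : ℤ) + 1)} +
        (w - u * w) * treeBR q A {0, -(c : ℤ)} := by linarith only [ihA]
    have ihB' : 0 ≤ (-1) * treeBR q B {0, -(a : ℤ), -((q : ℤ) - 1)} + (1 + u) * treeBR q B {0, -((a : ℤ) + 1)} +
        (w - u * w) * treeBR q B {0, -(c : ℤ)} := by linarith only [ihB]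
    -- R21 rows in the generated shapes
    have r21x1 : ∀ X : SumTree, 0 ≤ (-1 - u - u ^ 2) * treeBR q X {0, -1} + ((3 / 2) + u) * treeBR q X {0} := by
      intro X
      have h := rowR21 X 1 le_rfl (by omega)
      have e : (2 : ℚ) ^ (-((1 : ℕ) : ℤ)) = 1 / 2 := by norm_num
      rw [e] at h
      have e2 : ({0, -((1 : ℕ) : ℤ)} : Finset ℤ) = {0, -1} := by simp
      rw [e2] at h
      linarith only [h]
    have r21xtop : ∀ X : SumTree, 0 ≤ (-1 - u - u ^ 2) * treeBR q X {0, -((q : ℤ) - 1)} + (1 + 3 * u) * treeBR q X {0} := by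
      intro X
      have h := rowR21 X (q - 1) (by omega) (by omega)
      have e : (-(((q - 1 : ℕ) : ℤ))) = -((q : ℤ) - 1) := by omega
      rw [e, h2u] at h
      linarith only [h]
    have r21xc : ∀ X : SumTree, 0 ≤ (-w - u * w - u ^ 2 * w) * treeBR q X {0, -(c : ℤ)} + (w + u + u * w) * treeBR q X {0} := by
      intro X
      have h := rowR21 X c hc1 (by omega)
      have h' := mul_le_mul_of_nonneg_left h hw0'.le
      have e : w * ((1 + u + (2 : ℚ) ^ (-(c : ℤ))) * treeBR q X {0}) = (w + u * w + u) * treeBR q X {0} := by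
        rw [← mul_assoc, mul_add, mul_add, mul_comm w ((2 : ℚ) ^ (-(c : ℤ))), hcw]; ring
      rw [e] at h'
      linarith only [h']
    -- the LHS node value is 1 + (best of eight options) ≤ RHS
    have hb : ((q - 1 : ℕ) : ℤ) = (q : ℤ) - 1 := by omega
    have hR : 0 ≤ (1 + u) * NA1 + (1 - u) * w * NC - 1 := by
      have h1 : 1 ≤ NA1 := by
        linarith only [oA1_0ab, n0 A {0, -((a : ℤ) + 1)}, mul_nonneg hu0.le (n0 B {0})]
      have h2 : 0 ≤ (1 - u) * w * NC := mul_nonneg (mul_nonneg (by linarith only [hu1]) hw0'.le) (n0 _ _)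
      have h3 := mul_le_mul_of_nonneg_left h1 (by linarith only [hu0] : (0 : ℚ) ≤ 1 + u)
      linarith only [h2, h3, hu0]
    have key := treeBR_three_node_le hq1 A B ha (by omega : a < q - 1) (by omega) hR ?_
    · rw [hb] at key; linarith only [key]
    -- the eight branches
    rw [hb]
    -- shifts of the raw option expressions
    have eq1 : ∀ X : SumTree, treeBR q X {-(q : ℤ)} = u * treeBR q X {0} := fun X => by
      rw [treeBR_single_shift, huz]
    have eq2 : ∀ X : SumTree, treeBR q X {-((q : ℤ) - 1), -(q : ℤ)} = 2 * u * treeBR q X {0, -1} := fun X => by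
      rw [← h2u, ← treeBR_pair_shift X (-((q : ℤ) - 1)) (-1)]; congr 1; ext z; simp; omega
    have eq3 : ∀ X : SumTree, treeBR q X {-(a : ℤ), -(q : ℤ)} = 2 * w * treeBR q X {0, -((c : ℤ) + 1)} := fun X => by
      rw [← h2w, ← treeBR_pair_shift X (-(a : ℤ)) (-((c : ℤ) + 1))]; congr 1; ext z; simp; omega
    have eq4 : ∀ X : SumTree, treeBR q X {-(a : ℤ), -((q : ℤ) - 1), -(q : ℤ)} =
        2 * w * treeBR q X {0, -(c : ℤ), -((c : ℤ) + 1)} := fun X => by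
      rw [← h2w, ← treeBR_triple_shift X (-(a : ℤ)) (-(c : ℤ)) (-((c : ℤ) + 1))]; congr 1; ext z; simp; omega
    have b0 := oRow1_branch0 hu0 hu1 hw0 hw1 oA1_0ab oC_0ab ihA' (n0 B {0})
    have b0' := oRow1_branch0 hu0 hu1 hw0 hw1 oA1_0ba oC_0ba ihB' (n0 A {0})
    have b1 := oRow1_branch1 hu0 hu1 hw0 hw1 oA1_0ab oA1_1ba oC_0ab (rowR31 A) (r21x1 B) (n0 B {0})
    have b1' := oRow1_branch1 hu0 hu1 hw0 hw1 oA1_0ba oA1_1ab oC_0ba (rowR31 B) (r21x1 A) (n0 A {0})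
    have b2 := oRow1_branch2 hu0 hu1 hw0 hw1 oA1_1ab oA1_1ba oC_1ab oC_1ba (r21xtop A) (rowMtop A) (rowMC A)
      (rowM0 A _ (by omega) (by omega)) (rowMC B) (rowM0 B _ (by omega) (by omega)) (n0 B _)
    have b2' := oRow1_branch2 hu0 hu1 hw0 hw1 oA1_1ba oA1_1ab oC_1ba oC_1ab (r21xtop B) (rowMtop B) (rowMC B)
      (rowM0 B _ (by omega) (by omega)) (rowMC A) (rowM0 A _ (by omega) (by omega)) (n0 A _)
    have b3 := oRow1_branch3 hu0 hu1 hw0 hw1 oA1_1ab oA1_1ba oC_0ba (rowM0 A _ (by omega) (by omega)) (rowDEL B) (r21xc B) (n0 A _)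
    have b3' := oRow1_branch3 hu0 hu1 hw0 hw1 oA1_1ba oA1_1ab oC_0ab (rowM0 B _ (by omega) (by omega)) (rowDEL A) (r21xc A) (n0 B _)
    rw [eq1, eq1, eq2, eq2, eq3, eq3, eq4, eq4]
    refine max_le (max_le (max_le ?_ ?_) (max_le ?_ ?_)) (max_le (max_le ?_ ?_) (max_le ?_ ?_))
    · linarith only [b0]
    · linarith only [b1]
    · linarith only [b2]
    · linarith only [b3]
    · linarith only [b0']
    · linarith only [b1']
    · linarith only [b2']
    · linarith only [b3']

/-- **THE SINGLE-BIT TOP-LEVEL `O`-ROWS AT `ρ = u`, EVERY TREE, EVERY `q ≥ 4`** (opt R32 by value, in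
the budget units of parts 9d/10e): `ORow q t u (q-2) (2^i)` for every `i ≤ q - 3`, i.e. with
`β = 2^(q-2)`, `o = β + 2^i + ½`: `2 BR_t(o) ≤ (1+u) BR_t(o + β - ½) + (1-u) BR_t(o - β)`. -/
theorem oRow_top_singleBit (hq : 4 ≤ q) {i : ℕ} (hi : i + 3 ≤ q) (t : SumTree) :
    ORow q t (unitRoundoff q) (q - 2) (2 ^ i) := by
  have hq1 : 1 ≤ q := by omega
  unfold ORow
  -- a = q - 2 - i, c = q - 1 - a = i + 1
  obtain ⟨a, ha⟩ : ∃ a : ℕ, a = q - 2 - i := ⟨_, rfl⟩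
  have ha1 : 1 ≤ a := by omega
  have haq : a + 2 ≤ q := by omega
  have h := treeBR_oRow1 hq ha1 haq t
  have haz : (a : ℤ) = (q : ℤ) - 2 - i := by omega
  -- the three points as configurations
  have hσ : (2 : ℚ) ^ (q - 1) = (2 : ℚ) ^ ((q : ℤ) - 1) := by rw [← zpow_natCast]; congr 1; omega
  have hβ : (2 : ℚ) ^ (q - 2) = (2 : ℚ) ^ ((q : ℤ) - 2) := by rw [← zpow_natCast]; congr 1; omega
  have hA : ((2 ^ i : ℕ) : ℚ) = (2 : ℚ) ^ (i : ℤ) := by push_cast; exact (zpow_natCast 2 i).symm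
  have h21 : (2 : ℚ) ^ ((q : ℤ) - 1) = 2 * (2 : ℚ) ^ ((q : ℤ) - 2) := by
    rw [show (q : ℤ) - 1 = (q : ℤ) - 2 + 1 by ring, zpow_add_one₀ (by norm_num)]; ring
  have ho : (2 : ℚ) ^ (q - 1) - (2 : ℚ) ^ (q - 2) + ((2 ^ i : ℕ) : ℚ) + 1 / 2 =
      val ({((q : ℤ) - 2), (i : ℤ), -1} : Finset ℤ) := by
    unfold val
    rw [Finset.sum_insert (by simp only [Finset.mem_insert, Finset.mem_singleton]; omega),
      Finset.sum_pair (by omega), hσ, hβ, hA, h21, zpow_neg_one]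
    ring
  have ho1 : (2 : ℚ) ^ (q - 1) - (2 : ℚ) ^ (q - 2) + ((2 ^ i : ℕ) : ℚ) + 1 / 2 + (2 : ℚ) ^ (q - 2) - 1 / 2 =
      val ({((q : ℤ) - 1), (i : ℤ)} : Finset ℤ) := by
    rw [val_pair (by omega), hσ, hβ, hA]; ring
  have ho2 : (2 : ℚ) ^ (q - 1) - (2 : ℚ) ^ (q - 2) + ((2 ^ i : ℕ) : ℚ) + 1 / 2 - (2 : ℚ) ^ (q - 2) =
      val ({(i : ℤ), -1} : Finset ℤ) := by
    rw [val_pair (by omega), hσ, hβ, hA, h21, zpow_neg_one]; ring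
  rw [ho1, ho2, ho, treeBRv_val, treeBRv_val, treeBRv_val]
  -- shifts to the coordinates of `treeBR_oRow1`
  have s1 : treeBR q t {((q : ℤ) - 2), (i : ℤ), -1} = (2 : ℚ) ^ ((q : ℤ) - 2) * treeBR q t {0, -(a : ℤ), -((q : ℤ) - 1)} := by
    rw [← treeBR_triple_shift t ((q : ℤ) - 2) (-(a : ℤ)) (-((q : ℤ) - 1))]; congr 1; ext z; simp; omega
  have s2 : treeBR q t {((q : ℤ) - 1), (i : ℤ)} = (2 : ℚ) ^ ((q : ℤ) - 1) * treeBR q t {0, -((a : ℤ) + 1)} := by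
    rw [← treeBR_pair_shift t ((q : ℤ) - 1) (-((a : ℤ) + 1))]; congr 1; ext z; simp; omega
  have s3 : treeBR q t {(i : ℤ), -1} = (2 : ℚ) ^ (i : ℤ) * treeBR q t {0, -((q : ℤ) - 1 - a)} := by
    rw [← treeBR_pair_shift t (i : ℤ) (-((q : ℤ) - 1 - a))]; congr 1; ext z; simp; omega
  rw [s1, s2, s3, h21]
  have hi2 : (2 : ℚ) ^ (i : ℤ) = (2 : ℚ) ^ ((q : ℤ) - 1) * (2 : ℚ) ^ (-((a : ℤ) + 1)) := by
    rw [← zpow_add₀ (by norm_num : (2 : ℚ) ≠ 0)]; congr 1; omega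
  rw [hi2, h21]
  have hpos : 0 < (2 : ℚ) ^ ((q : ℤ) - 2) := zpow_pos (by norm_num) _
  have hu1 : 0 ≤ 1 - unitRoundoff q := by linarith only [unitRoundoff_le_one q]
  have h' := mul_le_mul_of_nonneg_left h hpos.le
  nlinarith [h', hpos, mul_nonneg hu1 (mul_nonneg (zpow_pos (by norm_num : (0:ℚ) < 2) (-((a : ℤ) + 1))).le (treeBR_nonneg q t {0, -((q : ℤ) - 1 - a)}))]

end R32

end Summit.Ventures.CertifiedArithmetic.LowPrec.Opt
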